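import Summits.MatrixMultiplication.MatrixMultiplication.Theorems.FarEdgeDescentChord
import Summits.MatrixMultiplication.MatrixMultiplication.Theorems.FarEdgeDescentGlue
import Summits.MatrixMultiplication.MatrixMultiplication.Theorems.FarEdgeDescentTailShadow
import HarnessLib

/-!
# Route `FarEdgeDescent` — THE CRUX IN FORMAT LANGUAGE: a binary quadratic form of Kronecker excesses,
# whose square-dominated half is a THEOREM and whose long-dominated half IS `AnchoredLogConvexity`
(lens-2 «special vs generic», gen 44, Kernel XX; def-free support module for the crux `AnchoredLogConvexity`
stmt-MatrixMultiplication-28900; companion of `FarEdgeDescentChord` (gen 8) and `FarEdgeDescentGapFraction` (gen 44);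
the cut of record `closes (h₁ : FiniteSaturation) (h₂ : AnchoredLogConvexity)` is UNCHANGED)

`e(x) := ω(1,x,1) − (x+1)` (excess over the information bound `x + 1` of the format `(1,x,1)`).  For integers
`p, q ≥ 1` and real `m > 1` put (all inline, no definitions)
* `T := ⟨n,n^m,n⟩^{⊗2pq}`, format `(2pq, 2pqm, 2pq)`, information bound `2pq + 2pqm`, and by homogeneity
  `ω(T) = 2pq·ω(1,m,1)` (`omegaRect_power`), so `excess(T) = 2pq·e(m)`;
* `S := ⟨n,n,n⟩^{⊗p²} ⊗ ⟨n,n^{2m−1},n⟩^{⊗q²}`, format `(p²+q², p²+(2m−1)q², p²+q²)`, information bound `2p² + 2mq²`,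
  KRONECKER COST `p²·ω(1,1,1) + q²·ω(1,2m−1,1) ≥ ω(S)` (`kronecker_cost`), KRONECKER EXCESS `p²·e(1) + q²·e(2m−1)`.
The format surplus of `S` over `T` is `(q−p)²` on each side and `(q−p)(q(2m−1)−p)` in the middle; its value at the
information rate («at par») is `(2p² + 2mq²) − (2pq + 2pqm) = 2(q−p)(mq−p)`.

THE QUADRATIC FORM `Q_m(p,q) := p²·e(1) − 2pq·e(m) + q²·e(2m−1) = KroneckerExcess(S) − excess(T)`.
* §1 `Q_m(p,q) ≥ 0` for `q ≤ p` (reals) is a THEOREM (`kroneckerExcess_sq_dominated`: the Lotti–Romani chord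
  `alc_chord` plus `e` antitone) — the SQUARE-dominated half; at `p = q` it is the chord itself (`T` and `S` have
  the same format `(2p², 2p²m, 2p²)`: the Kronecker identity `⟨n,n^m,n⟩^{⊗2} ≅ ⟨n,n,n⟩ ⊗ ⟨n,n^{2m−1},n⟩`).
* §2 `AnchoredLogConvexity ⟺ Q_m(p,q) ≥ 0` for all real `p, q` (`alc_iff_quadraticForm`, the `2×2` Hankel minor as
  a form) `⟺` for all INTEGERS `0 < p < q` (`alc_iff_kroneckerExcess`; density of `ℚ` in the negativity window of
  the form, which the chord confines to `(0,1)`) — the LONG-dominated half IS the crux.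
* §3 FORMAT READING (`alc_iff_formatSurplus`): for `p < q`, `T` is a SUB-FORMAT of `S`, so restriction gives the
  trivial `excess(T) ≤ KroneckerExcess(S) + 2(q−p)(mq−p)` (`excess_restriction_le`, monotonicity of `ω`); the crux
  says exactly `excess(T) ≤ KroneckerExcess(S)`: **restricting the Kronecker algorithm of the long-dominated
  anchored product `S` to the sub-format `T` can be done AT PAR — the whole format surplus is recoverable at the
  information rate.**  The special leaf `FiniteSaturation` is the ABSOLUTE par statement `ω(1,k,1) = k+1` at one
  far point; the generic leaf is this RELATIVE par statement.  (Replacing the Kronecker cost by the true `ω(S)`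
  gives a STRICTLY STRONGER statement: §4 `truePar_tooStrong` exhibits a 3D-LAWFUL world — far excess `¼·e^{1−x}` — in
  which the crux-shape holds with EQUALITY and the Kronecker-par family holds, but the true-cost par inequality FAILS at
  `(m,p,q) = (2,1,2)` (`4e(2) ≤ 5e(13/5)` is false); the Kronecker structure of `S` is load-bearing.)

* §4 `truePar_tooStrong`: the par statement is about the Kronecker ALGORITHM for `S`, not about `S` (see above).

This is the tensor-language form of memo U11 («which mechanism interpolates excesses geometrically?»): a
mechanism must convert discarded FORMAT of a Kronecker-structured bilinear algorithm into saved RANK at the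
information-theoretic exchange rate, for the products `⟨n,n,n⟩^{⊗p²} ⊗ ⟨n,n^{2m−1},n⟩^{⊗q²} ↓ ⟨n,n^m,n⟩^{⊗2pq}`,
`p < q`.  Nothing here proves `ω = 2`; tag of 28900 IDEA-NEEDED unchanged.
[cite: LottiRomani1983, §1 (p. 173)] [cite: HuangPan1998, §2 eq. (2.5)–(2.8)] [cite: LeGall2012, §2]
-/

set_option linter.dupNamespace false

noncomputable section

namespace Summit.MatrixMultiplication.MatrixMultiplication.Theorems.FarEdgeDescentFormatSurplus

open Literature.Computability.AlgebraicComplexity Set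
open Summit.MatrixMultiplication.MatrixMultiplication.Theses.FarEdgeDescent
open Summit.MatrixMultiplication.MatrixMultiplication.Theorems.FarEdgeDescentChord
open Summit.MatrixMultiplication.MatrixMultiplication.Theorems.FarEdgeDescentGlue (excess_nonneg)
open Summit.MatrixMultiplication.MatrixMultiplication.Theorems.FarEdgeDescentTailShadow (farTail_realisable)

/-! ## §0 An elementary fact about the three excesses (`e ≥ 0` is `FarEdgeDescentGlue.excess_nonneg`) -/

/-- `e(2m−1) ≤ e(1)` for `m ≥ 1` (`e` antitone). -/
theorem excess_two_le_one {m : ℝ} (hm : 1 ≤ m) :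
    omegaRect ℂ 1 (2 * m - 1) 1 - 2 * m ≤ omegaRect ℂ 1 1 1 - 2 := by
  have h := excess_antitone (x := 2 * m - 1) (y := 1) (by linarith)
  linarith

/-! ## §1 The square-dominated half of the form is a theorem -/

/-- **`Q_m(p,q) ≥ 0` for `0 ≤ q ≤ p` — PROVED** (true exponents, no hypotheses): `2pq·e(m) ≤ p²·e(1) + q²·e(2m−1)`.
Identity: `p²e(1) + q²e(2m−1) − 2pq·e(m) = 2pq·((e(1)+e(2m−1))/2 − e(m)) + (p−q)(p·e(1) − q·e(2m−1))`, both terms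
`≥ 0` by the chord `alc_chord` and `e(2m−1) ≤ e(1)`.  At `p = q` this is the chord. -/
theorem kroneckerExcess_sq_dominated {m : ℝ} (hm : 1 ≤ m) {p q : ℝ} (hq : 0 ≤ q) (hqp : q ≤ p) :
    2 * p * q * (omegaRect ℂ 1 m 1 - (m + 1)) ≤
      p ^ 2 * (omegaRect ℂ 1 1 1 - 2) + q ^ 2 * (omegaRect ℂ 1 (2 * m - 1) 1 - 2 * m) := by
  have hc := alc_chord hm
  have ha := excess_two_le_one hm
  have h3 := excess_nonneg_two m
  have hp : 0 ≤ p := hq.trans hqp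
  have h1 : 0 ≤ p * q * (((omegaRect ℂ 1 1 1 - 2) + (omegaRect ℂ 1 (2 * m - 1) 1 - 2 * m)) / 2 -
      (omegaRect ℂ 1 m 1 - (m + 1))) := mul_nonneg (mul_nonneg hp hq) (sub_nonneg.2 hc)
  have h2 : 0 ≤ (p - q) * (p * (omegaRect ℂ 1 1 1 - 2) - q * (omegaRect ℂ 1 (2 * m - 1) 1 - 2 * m)) := by
    refine mul_nonneg (sub_nonneg.2 hqp) ?_
    nlinarith [mul_nonneg (sub_nonneg.2 hqp) excess_one_nonneg, mul_nonneg hq (sub_nonneg.2 ha)]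
  nlinarith [h1, h2]

/-! ## §2 The crux is the form on all of `ℝ²`, equivalently on the integer points `0 < p < q` -/

/-- The crux gives `Q_m(p,q) ≥ 0` for ALL real `p, q`: `e(1)·Q = (p·e(1) − q·e(m))² + q²(e(1)e(2m−1) − e(m)²)`. -/
theorem kroneckerExcess_of_alc (hA : AnchoredLogConvexity) {m : ℝ} (hm : 1 < m) (p q : ℝ) :
    2 * p * q * (omegaRect ℂ 1 m 1 - (m + 1)) ≤
      p ^ 2 * (omegaRect ℂ 1 1 1 - 2) + q ^ 2 * (omegaRect ℂ 1 (2 * m - 1) 1 - 2 * m) := by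
  have h := hA m hm
  have h1 := excess_one_nonneg
  rcases h1.eq_or_lt with h0 | hpos
  · -- `e(1) = 0` forces `e(m) = 0`
    have hm0 : omegaRect ℂ 1 m 1 - (m + 1) = 0 := by
      have : (omegaRect ℂ 1 m 1 - (m + 1)) ^ 2 ≤ 0 := by rw [← h0, zero_mul] at h; exact h
      exact pow_eq_zero_iff (n := 2) (by norm_num) |>.1 (le_antisymm this (sq_nonneg _))
    rw [hm0, ← h0]
    nlinarith [excess_nonneg_two m, sq_nonneg q]
  · have key : (omegaRect ℂ 1 1 1 - 2) *
        (p ^ 2 * (omegaRect ℂ 1 1 1 - 2) + q ^ 2 * (omegaRect ℂ 1 (2 * m - 1) 1 - 2 * m) -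
          2 * p * q * (omegaRect ℂ 1 m 1 - (m + 1))) =
        (p * (omegaRect ℂ 1 1 1 - 2) - q * (omegaRect ℂ 1 m 1 - (m + 1))) ^ 2 +
          q ^ 2 * ((omegaRect ℂ 1 1 1 - 2) * (omegaRect ℂ 1 (2 * m - 1) 1 - 2 * m) -
            (omegaRect ℂ 1 m 1 - (m + 1)) ^ 2) := by ring
    have hnn : 0 ≤ (omegaRect ℂ 1 1 1 - 2) *
        (p ^ 2 * (omegaRect ℂ 1 1 1 - 2) + q ^ 2 * (omegaRect ℂ 1 (2 * m - 1) 1 - 2 * m) -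
          2 * p * q * (omegaRect ℂ 1 m 1 - (m + 1))) := by
      rw [key]; nlinarith [sq_nonneg (p * (omegaRect ℂ 1 1 1 - 2) - q * (omegaRect ℂ 1 m 1 - (m + 1))),
        mul_nonneg (sq_nonneg q) (sub_nonneg.2 h)]
    have h2 : (omegaRect ℂ 1 1 1 - 2) * 0 ≤ (omegaRect ℂ 1 1 1 - 2) *
        (p ^ 2 * (omegaRect ℂ 1 1 1 - 2) + q ^ 2 * (omegaRect ℂ 1 (2 * m - 1) 1 - 2 * m) -
          2 * p * q * (omegaRect ℂ 1 m 1 - (m + 1))) := by rw [mul_zero]; exact hnn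
    have := le_of_mul_le_mul_left h2 hpos
    linarith

/-- **`AnchoredLogConvexity ⟺ Q_m ≥ 0` on `ℝ²`** (the `2 × 2` Hankel minor as positivity of a binary form). -/
theorem alc_iff_quadraticForm : AnchoredLogConvexity ↔
    ∀ m : ℝ, 1 < m → ∀ p q : ℝ, 2 * p * q * (omegaRect ℂ 1 m 1 - (m + 1)) ≤
      p ^ 2 * (omegaRect ℂ 1 1 1 - 2) + q ^ 2 * (omegaRect ℂ 1 (2 * m - 1) 1 - 2 * m) := by
  refine ⟨fun hA m hm p q => kroneckerExcess_of_alc hA hm p q, fun h m hm => ?_⟩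
  -- evaluate the form at `(p, q) = (e(m), e(1))`
  have h1 := excess_one_nonneg
  have key := h m hm (omegaRect ℂ 1 m 1 - (m + 1)) (omegaRect ℂ 1 1 1 - 2)
  rcases h1.eq_or_lt with h0 | hpos
  · -- `e(1) = 0`: then `e(2m−1) = 0` and the form at `(1, q)` with `q` large forces `e(m) ≤ 0`
    have h3 : omegaRect ℂ 1 (2 * m - 1) 1 - 2 * m = 0 :=
      le_antisymm (h0 ▸ excess_two_le_one hm.le) (excess_nonneg_two m)
    have k := h m hm 1 ((omegaRect ℂ 1 m 1 - (m + 1)) + 1)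
    rw [← h0, h3] at k
    have hm0 := excess_nonneg m
    show (omegaRect ℂ 1 m 1 - (m + 1)) ^ 2 ≤ (omegaRect ℂ 1 1 1 - 2) * (omegaRect ℂ 1 (2 * m - 1) 1 - 2 * m)
    nlinarith [k, hm0]
  · show (omegaRect ℂ 1 m 1 - (m + 1)) ^ 2 ≤ (omegaRect ℂ 1 1 1 - 2) * (omegaRect ℂ 1 (2 * m - 1) 1 - 2 * m)
    -- key : 2·e(m)·e(1)·e(m) ≤ e(m)²·e(1) + e(1)²·e(2m−1), i.e. e(1)·(e(m)² − e(1)e(2m−1)) ≤ 0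
    have : (omegaRect ℂ 1 1 1 - 2) * ((omegaRect ℂ 1 m 1 - (m + 1)) ^ 2 -
        (omegaRect ℂ 1 1 1 - 2) * (omegaRect ℂ 1 (2 * m - 1) 1 - 2 * m)) ≤ (omegaRect ℂ 1 1 1 - 2) * 0 := by
      nlinarith [key]
    have := le_of_mul_le_mul_left this hpos
    linarith

/-- **`AnchoredLogConvexity ⟺ Q_m(p,q) ≥ 0` for all INTEGERS `0 < p < q`** — the LONG-dominated half of the form
(`q²` long factors `⟨n,n^{2m−1},n⟩` against `p² < q²` squares) IS the crux; the square-dominated half `q ≤ p`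
is §1's theorem.  `⇐`: if `e(m)² > e(1)e(2m−1)` the form `t ↦ t²e(1) − 2t·e(m) + e(2m−1)` is negative on a
window around its vertex `t₀ = e(m)/e(1)`; the chord (`Q_m(1,1) ≥ 0` and `e(m) ≤ e(1)`) keeps the window inside
`(0,1)`, and a rational `p/q` in it contradicts the hypothesis. -/
theorem alc_iff_kroneckerExcess : AnchoredLogConvexity ↔
    ∀ m : ℝ, 1 < m → ∀ p q : ℕ, 0 < p → p < q →
      2 * (p : ℝ) * q * (omegaRect ℂ 1 m 1 - (m + 1)) ≤
        (p : ℝ) ^ 2 * (omegaRect ℂ 1 1 1 - 2) + (q : ℝ) ^ 2 * (omegaRect ℂ 1 (2 * m - 1) 1 - 2 * m) := by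
  refine ⟨fun hA m hm p q _ _ => kroneckerExcess_of_alc hA hm p q, fun h m hm => ?_⟩
  set x : ℝ := omegaRect ℂ 1 1 1 - 2 with hx_def
  set y : ℝ := omegaRect ℂ 1 (2 * m - 1) 1 - 2 * m with hy_def
  set e : ℝ := omegaRect ℂ 1 m 1 - (m + 1) with he_def
  show e ^ 2 ≤ x * y
  have hx0 : 0 ≤ x := excess_one_nonneg
  have hy0 : 0 ≤ y := excess_nonneg_two m
  have he0 : 0 ≤ e := excess_nonneg m
  have hyx : y ≤ x := excess_two_le_one hm.le
  have hchord : e ≤ (x + y) / 2 := alc_chord hm.le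
  refine le_of_not_gt fun hne => ?_
  have hepos : 0 < e := by
    rcases he0.eq_or_lt with h0 | h0
    · exfalso; rw [← h0] at hne; nlinarith [mul_nonneg hx0 hy0]
    · exact h0
  rcases hx0.eq_or_lt with hx | hx
  · -- `x = 0`: then `y = 0` and `(p,q) = (1,2)` gives `4e ≤ 0`
    have hy : y = 0 := le_antisymm (hx ▸ hyx) hy0
    have k := h m hm 1 2 Nat.one_pos (by norm_num)
    rw [← hy_def, ← he_def, ← hx, hy] at k
    push_cast at k
    nlinarith [k]
  · -- `x > 0`: the negativity window around the vertex `t₀ = e/x`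
    set t₀ : ℝ := e / x with ht₀
    set δ : ℝ := (e ^ 2 - x * y) / x with hδ
    have hδ0 : 0 < δ := div_pos (by nlinarith) hx
    set w : ℝ := min 1 (δ / (x + 1)) with hw
    have hw0 : 0 < w := lt_min one_pos (div_pos hδ0 (by linarith))
    have hw1 : w ≤ 1 := min_le_left _ _
    have hw2 : w ≤ δ / (x + 1) := min_le_right _ _
    obtain ⟨r, hr1, hr2⟩ := exists_rat_btwn (show t₀ < t₀ + w by linarith)
    have ht₀0 : 0 < t₀ := div_pos hepos hx
    have hr0 : (0 : ℝ) < r := ht₀0.trans hr1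
    -- the form is negative at `r`
    have hfr : (r : ℝ) ^ 2 * x - 2 * r * e + y < 0 := by
      have hid : (r : ℝ) ^ 2 * x - 2 * r * e + y = x * ((r : ℝ) - t₀) ^ 2 - δ := by
        rw [ht₀, hδ]; field_simp; ring
      have hd0 : 0 < (r : ℝ) - t₀ := by linarith
      have hd1 : (r : ℝ) - t₀ < w := by linarith
      have h1 : ((r : ℝ) - t₀) ^ 2 < w ^ 2 := by nlinarith
      have h2 : x * ((r : ℝ) - t₀) ^ 2 < x * w ^ 2 := mul_lt_mul_of_pos_left h1 hx
      have h3 : x * w ^ 2 ≤ x * w :=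
        mul_le_mul_of_nonneg_left (by nlinarith [mul_nonneg hw0.le (sub_nonneg.2 hw1)]) hx.le
      have h4 : x * w ≤ x * (δ / (x + 1)) := mul_le_mul_of_nonneg_left hw2 hx.le
      have h5 : x * (δ / (x + 1)) < δ := by
        rw [mul_div_assoc', div_lt_iff₀ (by linarith : (0 : ℝ) < x + 1)]; nlinarith
      linarith
    -- hence `r < 1` (the form is `≥ 0` on `[1,∞)` by the chord)
    have hr_lt_one : (r : ℝ) < 1 := by
      refine lt_of_not_ge fun hge => ?_
      have hex : e ≤ x := by linarith
      have : 0 ≤ ((r : ℝ) - 1) * (((r : ℝ) + 1) * x - 2 * e) :=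
        mul_nonneg (sub_nonneg.2 hge) (by nlinarith)
      nlinarith [this, hchord]
    -- write `r = p/q` with `0 < p < q`
    have hnum : 0 < r.num := Rat.num_pos.2 (by exact_mod_cast hr0)
    set p : ℕ := r.num.toNat with hp
    set q : ℕ := r.den with hq
    have hpz : (p : ℤ) = r.num := Int.toNat_of_nonneg hnum.le
    have hq0 : 0 < q := r.den_pos
    have hqR : (0 : ℝ) < q := by exact_mod_cast hq0
    have hrpq : (r : ℝ) = (p : ℝ) / (q : ℝ) := by
      have h1 : (r : ℝ) = (r.num : ℝ) / (r.den : ℝ) := Rat.cast_def r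
      have h2 : ((p : ℤ) : ℝ) = (r.num : ℝ) := by exact_mod_cast hpz
      have h3 : (r.num : ℝ) = (p : ℝ) := by rw [← h2]; exact Int.cast_natCast p
      rw [h1, h3]
    have hpR : (p : ℝ) = r * q := by rw [hrpq]; field_simp
    have hp0 : 0 < p := Int.lt_toNat.2 (by simpa using hnum)
    have hpq : p < q := by
      have : (p : ℝ) < q := by rw [hpR]; nlinarith
      exact_mod_cast this
    have k := h m hm p q hp0 hpq
    rw [← hy_def, ← he_def, hpR] at k
    -- k : 2·(rq)·q·e ≤ (rq)²·x + q²·y, i.e. q²·(form at r) ≥ 0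
    have : 0 ≤ (q : ℝ) ^ 2 * ((r : ℝ) ^ 2 * x - 2 * r * e + y) := by nlinarith [k]
    have := (mul_nonneg_iff_of_pos_left (by positivity : (0 : ℝ) < (q : ℝ) ^ 2)).1 this
    linarith

/-! ## §3 The format reading: Kronecker cost, trivial restriction, and restriction at par -/

/-- `ω(T) = 2pq·ω(1,m,1)` for `T = ⟨n,n^m,n⟩^{⊗2pq}` (homogeneity, Lotti–Romani §1), any real `ν = 2pq ≥ 0`. -/
theorem omegaRect_power {ν m : ℝ} (hν : 0 ≤ ν) (hm : 0 ≤ m) :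
    omegaRect ℂ ν (ν * m) ν = ν * omegaRect ℂ 1 m 1 := by
  have h := LottiRomani1983_homogeneous ℂ (x := 1) (y := m) (z := 1) hν zero_le_one hm zero_le_one
  rwa [mul_one] at h

/-- **Kronecker cost of `S = ⟨n,n,n⟩^{⊗p²} ⊗ ⟨n,n^{2m−1},n⟩^{⊗q²}`**: `ω(p²+q², p²+(2m−1)q², p²+q²) ≤
p²·ω(1,1,1) + q²·ω(1,2m−1,1)` (subadditivity and homogeneity), for real weights `a = p², b = q² ≥ 0`. -/
theorem kronecker_cost {m a b : ℝ} (hm : 1 ≤ m) (ha : 0 ≤ a) (hb : 0 ≤ b) :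
    omegaRect ℂ (a + b) (a + (2 * m - 1) * b) (a + b) ≤
      a * omegaRect ℂ 1 1 1 + b * omegaRect ℂ 1 (2 * m - 1) 1 := by
  have hm' : (0 : ℝ) ≤ 2 * m - 1 := by linarith
  have h := LottiRomani1983_subadditive ℂ (a * 1) (a * 1) (a * 1) (b * 1) (b * (2 * m - 1)) (b * 1)
  rw [LottiRomani1983_homogeneous ℂ ha zero_le_one zero_le_one zero_le_one,
    LottiRomani1983_homogeneous ℂ hb zero_le_one hm' zero_le_one] at h
  have e1 : a * 1 + b * 1 = a + b := by ring
  have e2 : a * 1 + b * (2 * m - 1) = a + (2 * m - 1) * b := by ring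
  rwa [e1, e2] at h

/-- **Trivial restriction (PROVED).** For `0 ≤ p ≤ q` the format of `T` is contained in that of `S`, so
`ω(T) ≤ ω(S) ≤ KroneckerCost(S)`; in excess form: `excess(T) ≤ KroneckerExcess(S) + 2(q−p)(mq−p)` — the
format surplus is simply WASTED. -/
theorem excess_restriction_le {m : ℝ} (hm : 1 ≤ m) {p q : ℝ} (hp : 0 ≤ p) (hpq : p ≤ q) :
    omegaRect ℂ (2 * p * q) (2 * p * q * m) (2 * p * q) - (2 * p * q + 2 * p * q * m) ≤
      (p ^ 2 * (omegaRect ℂ 1 1 1 - 2) + q ^ 2 * (omegaRect ℂ 1 (2 * m - 1) 1 - 2 * m)) +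
        2 * (q - p) * (m * q - p) := by
  have hq : 0 ≤ q := hp.trans hpq
  have hside : 2 * p * q ≤ p ^ 2 + q ^ 2 := by nlinarith [sq_nonneg (q - p)]
  have hmid : 2 * p * q * m ≤ p ^ 2 + (2 * m - 1) * q ^ 2 := by
    nlinarith [mul_nonneg (sub_nonneg.2 hpq) (by nlinarith : 0 ≤ 2 * m * q - p - q)]
  -- monotonicity of `ω` under format containment (zero padding, Bläser 2013 Lemma 5.4)
  have hmono : omegaRect ℂ (2 * p * q) (2 * p * q * m) (2 * p * q) ≤
      omegaRect ℂ (p ^ 2 + q ^ 2) (p ^ 2 + (2 * m - 1) * q ^ 2) (p ^ 2 + q ^ 2) := by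
    refine csInf_le_csInf (rectAdmissibleExponents_bddBelow ℂ _ _ _)
      (rectAdmissibleExponents_nonempty ℂ _ _ _) fun β hβ => ?_
    refine Asymptotics.IsBigO.trans (Asymptotics.IsBigO.of_bound 1 ?_) hβ
    filter_upwards [Filter.eventually_ge_atTop 1] with n hn
    rw [one_mul, Real.norm_of_nonneg (Nat.cast_nonneg _), Real.norm_of_nonneg (Nat.cast_nonneg _)]
    exact_mod_cast tensorRank_matMulTensor_mono₃ ℂ (rectDim_mono hn hside) (rectDim_mono hn hmid)
      (rectDim_mono hn hside)
  have hk := kronecker_cost hm (sq_nonneg p) (sq_nonneg q)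
  nlinarith [hmono, hk]

/-- ★ **THE CRUX = RESTRICTION AT PAR.**  `AnchoredLogConvexity` holds iff for every real `m > 1` and all integers
`0 < p < q`:  `excess(⟨n,n^m,n⟩^{⊗2pq}) ≤ KroneckerExcess(⟨n,n,n⟩^{⊗p²} ⊗ ⟨n,n^{2m−1},n⟩^{⊗q²})`, i.e.
`ω(2pq, 2pqm, 2pq) − (2pq + 2pqm) ≤ (p²·ω(1,1,1) + q²·ω(1,2m−1,1)) − (2p² + 2mq²)` — the trivial restriction
bound `excess_restriction_le` improved by exactly the par value `2(q−p)(mq−p)` of the format surplus. -/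
theorem alc_iff_formatSurplus : AnchoredLogConvexity ↔
    ∀ m : ℝ, 1 < m → ∀ p q : ℕ, 0 < p → p < q →
      omegaRect ℂ (2 * p * q) (2 * p * q * m) (2 * p * q) - (2 * (p : ℝ) * q + 2 * p * q * m) ≤
        ((p : ℝ) ^ 2 * omegaRect ℂ 1 1 1 + (q : ℝ) ^ 2 * omegaRect ℂ 1 (2 * m - 1) 1) -
          (2 * (p : ℝ) ^ 2 + 2 * m * (q : ℝ) ^ 2) := by
  rw [alc_iff_kroneckerExcess]
  refine forall_congr' fun m => forall_congr' fun hm => forall_congr' fun p => forall_congr' fun q =>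
    forall_congr' fun _ => forall_congr' fun _ => ?_
  have hν : (0 : ℝ) ≤ 2 * p * q := by positivity
  rw [omegaRect_power hν (by linarith : (0 : ℝ) ≤ m)]
  constructor <;> intro h <;> nlinarith [h]

/-- **The two halves side by side** (dichotomy inside one form): the square-dominated half `q ≤ p` of
`Q_m ≥ 0` holds for the TRUE exponents; the long-dominated half `p < q` is equivalent to the crux; and the
summit gives the whole form with `Q_m ≡ 0` (all three excesses vanish). -/
theorem quadraticForm_dichotomy :
    (∀ m : ℝ, 1 ≤ m → ∀ p q : ℝ, 0 ≤ q → q ≤ p →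
        2 * p * q * (omegaRect ℂ 1 m 1 - (m + 1)) ≤
          p ^ 2 * (omegaRect ℂ 1 1 1 - 2) + q ^ 2 * (omegaRect ℂ 1 (2 * m - 1) 1 - 2 * m)) ∧
    (AnchoredLogConvexity ↔ ∀ m : ℝ, 1 < m → ∀ p q : ℕ, 0 < p → p < q →
        2 * (p : ℝ) * q * (omegaRect ℂ 1 m 1 - (m + 1)) ≤
          (p : ℝ) ^ 2 * (omegaRect ℂ 1 1 1 - 2) + (q : ℝ) ^ 2 * (omegaRect ℂ 1 (2 * m - 1) 1 - 2 * m)) ∧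
    (_root_.MatrixMultiplication → ∀ m : ℝ, 1 ≤ m → ∀ p q : ℝ,
        p ^ 2 * (omegaRect ℂ 1 1 1 - 2) - 2 * p * q * (omegaRect ℂ 1 m 1 - (m + 1)) +
          q ^ 2 * (omegaRect ℂ 1 (2 * m - 1) 1 - 2 * m) = 0) := by
  refine ⟨fun m hm p q hq hqp => kroneckerExcess_sq_dominated hm hq hqp, alc_iff_kroneckerExcess, ?_⟩
  intro hS m hm p q
  have hω : omega ℂ = 2 := hS
  have e1 : omegaRect ℂ 1 1 1 - 2 = 0 := by rw [saturated_of_omega_eq_two hω le_rfl]; ring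
  have em : omegaRect ℂ 1 m 1 - (m + 1) = 0 := by rw [saturated_of_omega_eq_two hω hm]; ring
  have e2 : omegaRect ℂ 1 (2 * m - 1) 1 - 2 * m = 0 := by
    rw [saturated_of_omega_eq_two hω (by linarith : (1 : ℝ) ≤ 2 * m - 1)]; ring
  rw [e1, em, e2]; ring

/-! ## §4 The true-cost version is too strong: a lawful world -/

/-- **Restriction at par relative to the TRUE cost of `S` is strictly stronger than the crux (modulo the shape laws).**
In the 3D-lawful world with far excess `e(x) = ¼·e^{1−x}` (convex, antitone, `≥ 0`, cube line with equality of slopes;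
realised by `farTail_realisable`): the crux-shape holds (with equality), hence the Kronecker-par family
`excess_W(T) ≤ p²e(1) + q²e(2m−1)` holds for all real `p, q`; but `excess_W(T) ≤ excess_W(S)` with the TRUE value
`W(S)` fails at `m = 2, p = 1, q = 2`: there `W(4,8,4) − 12 = 4e(2)` and `W(5,13,5) − 18 = 5e(13/5)`, and
`4e^{−1} > 5e^{−8/5}` because `e^{3/5} ≥ 8/5 > 5/4`. -/
theorem truePar_tooStrong : ∃ W : ℝ → ℝ → ℝ → ℝ,
    ((∀ a b c : ℝ, W a b c = W b a c ∧ W a b c = W a c b) ∧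
      (∀ ν : ℝ, 0 < ν → ∀ a b c : ℝ, 0 < a → 0 < b → 0 < c → W (ν * a) (ν * b) (ν * c) = ν * W a b c) ∧
      (∀ a b c a' b' c' : ℝ, 0 < a → 0 < b → 0 < c → 0 < a' → 0 < b' → 0 < c' →
        W (a + a') (b + b') (c + c') ≤ W a b c + W a' b' c') ∧
      (∀ a b b' c : ℝ, 0 < a → 0 < b → b ≤ b' → 0 < c → W a b c ≤ W a b' c) ∧
      (∀ a b c : ℝ, 0 < a → 0 < b → 0 < c →
        max (a + c) (max (a + b) (b + c)) ≤ W a b c ∧ W a b c ≤ a + b + c)) ∧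
    (∀ m : ℝ, 1 < m → (W 1 m 1 - (m + 1)) ^ 2 ≤ (W 1 1 1 - 2) * (W 1 (2 * m - 1) 1 - 2 * m)) ∧
    (∀ m : ℝ, 1 < m → ∀ p q : ℝ,
      2 * p * q * (W 1 m 1 - (m + 1)) ≤ p ^ 2 * (W 1 1 1 - 2) + q ^ 2 * (W 1 (2 * m - 1) 1 - 2 * m)) ∧
    ¬ (∀ m : ℝ, 1 < m → ∀ p q : ℕ, 0 < p → p < q →
      W (2 * p * q) (2 * p * q * m) (2 * p * q) - (2 * (p : ℝ) * q + 2 * p * q * m) ≤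
        W ((p : ℝ) ^ 2 + q ^ 2) ((p : ℝ) ^ 2 + (2 * m - 1) * q ^ 2) ((p : ℝ) ^ 2 + q ^ 2) -
          (2 * (p : ℝ) ^ 2 + 2 * m * (q : ℝ) ^ 2)) := by
  set c : ℝ := Real.exp 1 / 4 with hc
  have hc0 : 0 < c := by positivity
  let e : ℝ → ℝ := fun x => c * Real.exp (-x)
  have he1 : e 1 = 1 / 4 := by
    show Real.exp 1 / 4 * Real.exp (-1) = 1 / 4
    rw [div_mul_eq_mul_div, ← Real.exp_add]; norm_num
  have hconv : ConvexOn ℝ (Ici (1 : ℝ)) e := by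
    refine ⟨convex_Ici 1, fun x _ y _ a b ha hb hab => ?_⟩
    have h := convexOn_exp.2 (Set.mem_univ (-x)) (Set.mem_univ (-y)) ha hb hab
    simp only [smul_eq_mul] at h ⊢
    show c * Real.exp (-(a * x + b * y)) ≤ a * (c * Real.exp (-x)) + b * (c * Real.exp (-y))
    rw [show -(a * x + b * y) = a * -x + b * -y by ring]
    nlinarith [h, hc0]
  have hanti : AntitoneOn e (Ici (1 : ℝ)) := by
    intro x _ y _ hxy
    show c * Real.exp (-y) ≤ c * Real.exp (-x)
    exact mul_le_mul_of_nonneg_left (Real.exp_le_exp.2 (by linarith)) hc0.le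
  have hnn : ∀ x : ℝ, 1 ≤ x → 0 ≤ e x := fun x _ => by positivity
  have hcube : ∀ x : ℝ, 1 ≤ x → e 1 - e x ≤ (1 - e 1) / 3 * (x - 1) := by
    intro x hx
    rw [he1]
    show 1 / 4 - Real.exp 1 / 4 * Real.exp (-x) ≤ (1 - 1 / 4) / 3 * (x - 1)
    have h1 : Real.exp 1 * Real.exp (-x) = Real.exp (1 - x) := by rw [← Real.exp_add]; ring_nf
    have h2 := Real.add_one_le_exp (1 - x)
    nlinarith [h1, h2]
  obtain ⟨W, hsym, hhom, hsub, hmono, hsand, hfar, hone⟩ := farTail_realisable hconv hanti hnn hcube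
  -- the crux-shape with equality
  have halc : ∀ m : ℝ, 1 < m → (W 1 m 1 - (m + 1)) ^ 2 ≤ (W 1 1 1 - 2) * (W 1 (2 * m - 1) 1 - 2 * m) := by
    intro m hm
    rw [hfar m hm.le, hone, hfar (2 * m - 1) (by linarith)]
    show (m + 1 + c * Real.exp (-m) - (m + 1)) ^ 2 ≤
      (2 + c * Real.exp (-1) - 2) * (2 * m - 1 + 1 + c * Real.exp (-(2 * m - 1)) - 2 * m)
    have h : Real.exp (-m) ^ 2 = Real.exp (-1) * Real.exp (-(2 * m - 1)) := by
      rw [sq, ← Real.exp_add, ← Real.exp_add]; ring_nf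
    exact le_of_eq (by linear_combination c ^ 2 * h)
  refine ⟨W, ⟨hsym, hhom, hsub, hmono, hsand⟩, halc, fun m hm p q => ?_, fun H => ?_⟩
  · -- Kronecker-par: `e(1)·Q = (p·e(1) − q·e(m))² + q²(e(1)e(2m−1) − e(m)²) ≥ 0`, `e(1) = 1/4 > 0`
    have h := halc m hm
    have h1 : W 1 1 1 - 2 = 1 / 4 := by rw [hone, he1]; ring
    rw [h1] at h ⊢
    nlinarith [sq_nonneg (p * (1 / 4) - q * (W 1 m 1 - (m + 1))), mul_nonneg (sq_nonneg q) (sub_nonneg.2 h)]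
  · -- the true-cost par inequality fails at `m = 2`, `p = 1`, `q = 2`
    have k := H 2 (by norm_num) 1 2 Nat.one_pos (by norm_num)
    norm_num at k
    have h4 : W 4 8 4 = 4 * W 1 2 1 := by
      have := hhom 4 (by norm_num) 1 2 1 one_pos two_pos one_pos; norm_num at this; exact this
    have h5 : W 5 13 5 = 5 * W 1 (13 / 5) 1 := by
      have := hhom 5 (by norm_num) 1 (13 / 5) 1 one_pos (by norm_num) one_pos; norm_num at this; exact this
    rw [h4, h5, hfar 2 (by norm_num), hfar (13 / 5) (by norm_num)] at k
    -- k : 4·e(2) ≤ 5·e(13/5), i.e. 4·exp(−2) ≤ 5·exp(−13/5)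
    have hsplit : Real.exp (-2) = Real.exp (-(13 / 5)) * Real.exp (3 / 5) := by
      rw [← Real.exp_add]; norm_num
    have h35 : (8 / 5 : ℝ) ≤ Real.exp (3 / 5) := by
      have := Real.add_one_le_exp (3 / 5 : ℝ); norm_num at this ⊢; linarith
    have k' : 4 * (c * Real.exp (-2)) ≤ 5 * (c * Real.exp (-(13 / 5))) := by linarith [k]
    rw [hsplit] at k'
    nlinarith [mul_pos hc0 (Real.exp_pos (-(13 / 5) : ℝ)), h35]

end Summit.MatrixMultiplication.MatrixMultiplication.Theorems.FarEdgeDescentFormatSurplus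

end
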